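import Mathlib
import Summits.Ventures.PercRepro2.RowC1E1

/-!
# The three-copy Bernstein expansion of row 2′C1 and its typed triple base
(blind cell PercRepro2, p2 g30; proofs/P2-G30-C1.md §7–§9)

Row 2′C1 reads `P(Q, b ∈ C₂)·P(Q, o ∈ U) ≤ P(Q)·P(Q, o ∈ U, b ∈ U)`.  Its two-copy Bernstein (pattern)
coefficients are NOT all nonnegative (18 negative ones at `n = 7`, kit j328245), so no two-copy
injection proves it.  Multiplying by `P(Q)` gives a THREE-copy expansion: with the triple profile
`σ(ω₁, ω₂, ω₃)(e) = #{i : ω_i e = true} ∈ {0, 1, 2, 3}` and the triple weight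
`w_σ = ∏_e p_e^{σ_e} (1 − p_e)^{3 − σ_e}`,

  `P(F)P(G)P(H) − P(K)P(L)P(M) = ∑_σ w_σ · c(σ)`,
  `c(σ) = #{(ω₁,ω₂,ω₃) : σ(ω₁,ω₂,ω₃) = σ, ω₁ ∈ F, ω₂ ∈ G, ω₃ ∈ H} − #{…, ω₁ ∈ K, ω₂ ∈ L, ω₃ ∈ M}`

(`tripleCoeff`, an integer; `slack3_eq_sum_tripleCoeff`).  For the row, `F = G = K = Q`,
`H = Q ∩ {o ∈ U} ∩ {b ∈ U}`, `L = Q ∩ {b ∈ C₂}`, `M = Q ∩ {o ∈ U}`: the coefficients `c(σ)` are the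
**typed triple base** of the row (`C1TripleCoeff`), and **`c1_of_tripleCoeff_nonneg`** proves the row
for every admissible weight vector from their nonnegativity (`C1TripleBaseNonneg`).  That
nonnegativity is a CONJECTURE of the cell: 0 negative among 25,793,141,786 coefficients (kit j329565:
n = 6, all 360 markings of 2,800 graphs; n = 7, all 840 markings of 72 graphs), two codes on the seed
instances — the same shape as the crux 2′TRI (a nonnegative typed 3-copy base over a 2-copy base
that is not).  Std axioms.
-/

namespace Summit.Ventures.PercRepro2

namespace RowC1

section Triple

variable {E : Type*} [Fintype E] [DecidableEq E] {R : Type*} [CommRing R]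

/-- The triple profile: the number of copies in which the edge `e` is open. -/
def tripleProfile (ω₁ ω₂ ω₃ : Config E) : E → Fin 4 := fun e =>
  ⟨(if ω₁ e then 1 else 0) + (if ω₂ e then 1 else 0) + (if ω₃ e then 1 else 0), by
    split_ifs <;> omega⟩

/-- The triple weight `∏_e p_e^{σ_e} (1 − p_e)^{3 − σ_e}`. -/
def tripleWeight (p : E → R) (σ : E → Fin 4) : R :=
  ∏ e, p e ^ (σ e : ℕ) * (1 - p e) ^ (3 - (σ e : ℕ))

omit [Fintype E] [DecidableEq E] in
/-- One edge of the triple weight identity. -/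
lemma edgeFactor_three (q : R) (b₁ b₂ b₃ : Bool) :
    edgeFactor q b₁ * edgeFactor q b₂ * edgeFactor q b₃ =
      q ^ ((if b₁ then 1 else 0) + (if b₂ then 1 else 0) + (if b₃ then 1 else 0) : ℕ) *
        (1 - q) ^ (3 - ((if b₁ then 1 else 0) + (if b₂ then 1 else 0) + (if b₃ then 1 else 0) : ℕ)) := by
  cases b₁ <;> cases b₂ <;> cases b₃ <;> simp [edgeFactor] <;> ring

omit [DecidableEq E] in
/-- **The triple weight identity**: `w(ω₁) w(ω₂) w(ω₃) = w_{σ(ω₁,ω₂,ω₃)}`. -/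
lemma weight_mul_three (p : E → R) (ω₁ ω₂ ω₃ : Config E) :
    weight p ω₁ * weight p ω₂ * weight p ω₃ = tripleWeight p (tripleProfile ω₁ ω₂ ω₃) := by
  unfold weight tripleWeight
  rw [← Finset.prod_mul_distrib, ← Finset.prod_mul_distrib]
  refine Finset.prod_congr rfl fun e _ => ?_
  rw [edgeFactor_three]
  rfl

open Classical in
/-- The triple term `1_F(ω₁)1_G(ω₂)1_H(ω₃) − 1_K(ω₁)1_L(ω₂)1_M(ω₃)` (an integer). -/
noncomputable def tripleTerm (F G H K L M : Set (Config E)) (t : Config E × Config E × Config E) : ℤ :=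
  (if t.1 ∈ F then 1 else 0) * (if t.2.1 ∈ G then 1 else 0) * (if t.2.2 ∈ H then 1 else 0) -
    (if t.1 ∈ K then 1 else 0) * (if t.2.1 ∈ L then 1 else 0) * (if t.2.2 ∈ M then 1 else 0)

open Classical in
/-- The triple coefficient at the profile `σ`: the sum of the triple terms over the ordered triples of
profile `σ` (the number of triples in `F × G × H` minus the number in `K × L × M`). -/
noncomputable def tripleCoeff (F G H K L M : Set (Config E)) (σ : E → Fin 4) : ℤ :=
  ∑ t : Config E × Config E × Config E,
    if tripleProfile t.1 t.2.1 t.2.2 = σ then tripleTerm F G H K L M t else 0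

open Classical in
/-- `prob` as a sum of weight times a `0/1` indicator (integer indicator, cast). -/
lemma prob_eq_sum_weight_mul_int (p : E → R) (A : Set (Config E)) :
    prob p A = ∑ ω, weight p ω * ((if ω ∈ A then (1 : ℤ) else 0) : R) := by
  unfold prob
  refine Finset.sum_congr rfl fun ω _ => ?_
  by_cases h : ω ∈ A <;> simp [Set.indicator, h]

open Classical in
/-- **Three-configuration Bernstein expansion**:
`P(F)P(G)P(H) − P(K)P(L)P(M) = ∑_σ w_σ · c(σ)`. -/
theorem slack3_eq_sum_tripleCoeff (p : E → R) (F G H K L M : Set (Config E)) :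
    prob p F * prob p G * prob p H - prob p K * prob p L * prob p M =
      ∑ σ : E → Fin 4, tripleWeight p σ * (tripleCoeff F G H K L M σ : R) := by
  -- a product of three sums is a sum over ordered triples
  have sum3 : ∀ f g h : Config E → R, (∑ a, f a) * (∑ b, g b) * (∑ c, h c) =
      ∑ t : Config E × Config E × Config E, f t.1 * g t.2.1 * h t.2.2 := by
    intro f g h
    rw [Fintype.sum_prod_type]
    simp_rw [Fintype.sum_prod_type]
    rw [Finset.sum_mul_sum, Finset.sum_mul]
    refine Finset.sum_congr rfl fun a _ => ?_
    rw [Finset.sum_mul]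
    refine Finset.sum_congr rfl fun b _ => ?_
    rw [Finset.mul_sum]
  -- the left side as a sum over ordered triples
  have e1 : prob p F * prob p G * prob p H - prob p K * prob p L * prob p M =
      ∑ t : Config E × Config E × Config E,
        weight p t.1 * weight p t.2.1 * weight p t.2.2 * (tripleTerm F G H K L M t : R) := by
    rw [prob_eq_sum_weight_mul_int p F, prob_eq_sum_weight_mul_int p G, prob_eq_sum_weight_mul_int p H,
      prob_eq_sum_weight_mul_int p K, prob_eq_sum_weight_mul_int p L, prob_eq_sum_weight_mul_int p M,
      sum3, sum3, ← Finset.sum_sub_distrib]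
    refine Finset.sum_congr rfl fun t _ => ?_
    unfold tripleTerm
    push_cast
    ring
  rw [e1]
  unfold tripleCoeff
  simp only [Int.cast_sum, Finset.mul_sum]
  rw [Finset.sum_comm]
  refine Finset.sum_congr rfl fun t _ => ?_
  have key : ∀ σ : E → Fin 4,
      tripleWeight p σ * ((if tripleProfile t.1 t.2.1 t.2.2 = σ then tripleTerm F G H K L M t else 0 : ℤ) : R)
        = if tripleProfile t.1 t.2.1 t.2.2 = σ then
            tripleWeight p (tripleProfile t.1 t.2.1 t.2.2) * (tripleTerm F G H K L M t : R) else 0 := by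
    intro σ
    by_cases h : tripleProfile t.1 t.2.1 t.2.2 = σ
    · rw [if_pos h, if_pos h, ← h]
    · rw [if_neg h, if_neg h]; simp
  simp only [key]
  rw [Finset.sum_ite_eq, if_pos (Finset.mem_univ _), weight_mul_three]

end Triple

section TripleRow

variable {V : Type*} {E : Type*} [Fintype E] [DecidableEq E]
  {R : Type*} [CommRing R] [LinearOrder R] [IsStrictOrderedRing R]

/-- The typed triple base of row 2′C1: the triple coefficients of
`P(Q)·P(Q)·P(Q, o ∈ U, b ∈ U) − P(Q)·P(Q, b ∈ C₂)·P(Q, o ∈ U)`. -/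
noncomputable def C1TripleCoeff (ends : E → Sym2 V) (a₁ a₂ o b : V) (σ : E → Fin 4) : ℤ :=
  tripleCoeff (connEvent ends a₁ a₂)ᶜ (connEvent ends a₁ a₂)ᶜ
    ((connEvent ends a₁ o ∪ connEvent ends a₂ o) ∩ (connEvent ends a₁ b ∪ connEvent ends a₂ b) ∩
      (connEvent ends a₁ a₂)ᶜ)
    (connEvent ends a₁ a₂)ᶜ (connEvent ends a₂ b ∩ (connEvent ends a₁ a₂)ᶜ)
    ((connEvent ends a₁ o ∪ connEvent ends a₂ o) ∩ (connEvent ends a₁ a₂)ᶜ) σ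

/-- **The typed triple base of row 2′C1 is nonnegative** — a CONJECTURE of the cell (p2 g30; kit j329565:
0 negative among 25,793,141,786 coefficients at `n = 6, 7`). -/
def C1TripleBaseNonneg (ends : E → Sym2 V) (a₁ a₂ o b : V) : Prop :=
  ∀ σ : E → Fin 4, 0 ≤ C1TripleCoeff ends a₁ a₂ o b σ

omit [DecidableEq E] in
/-- The triple weight is nonnegative for admissible weights. -/
lemma tripleWeight_nonneg {p : E → R} (hp : IsProbVec p) (σ : E → Fin 4) :
    0 ≤ tripleWeight p σ := by
  unfold tripleWeight
  refine Finset.prod_nonneg fun e _ => mul_nonneg (pow_nonneg (hp.nonneg e) _)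
    (pow_nonneg (sub_nonneg.2 (hp.le_one e)) _)

/-- **Row 2′C1 from the nonnegativity of its typed triple base**, for every admissible weight vector:
`P(Q)·[P(Q)P(Q, o ∈ U, b ∈ U) − P(Q, b ∈ C₂)P(Q, o ∈ U)] = ∑_σ w_σ c(σ) ≥ 0`, and `P(Q, b ∈ C₂) ≤ P(Q)`
settles the case `P(Q) = 0`. -/
theorem c1_of_tripleCoeff_nonneg (p : E → R) (hp : IsProbVec p) (ends : E → Sym2 V) (a₁ a₂ o b : V)
    (h : C1TripleBaseNonneg ends a₁ a₂ o b) :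
    prob p (connEvent ends a₂ b ∩ (connEvent ends a₁ a₂)ᶜ) *
      prob p ((connEvent ends a₁ o ∪ connEvent ends a₂ o) ∩ (connEvent ends a₁ a₂)ᶜ) ≤
    prob p (connEvent ends a₁ a₂)ᶜ *
      prob p ((connEvent ends a₁ o ∪ connEvent ends a₂ o) ∩
        (connEvent ends a₁ b ∪ connEvent ends a₂ b) ∩ (connEvent ends a₁ a₂)ᶜ) := by
  set Q := (connEvent ends a₁ a₂)ᶜ with hQ
  have hsum : 0 ≤ prob p Q * prob p Q *
      prob p ((connEvent ends a₁ o ∪ connEvent ends a₂ o) ∩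
        (connEvent ends a₁ b ∪ connEvent ends a₂ b) ∩ Q) -
      prob p Q * prob p (connEvent ends a₂ b ∩ Q) *
        prob p ((connEvent ends a₁ o ∪ connEvent ends a₂ o) ∩ Q) := by
    rw [slack3_eq_sum_tripleCoeff]
    refine Finset.sum_nonneg fun σ _ => mul_nonneg (tripleWeight_nonneg hp σ) ?_
    exact_mod_cast h σ
  have hQ0 : 0 ≤ prob p Q := prob_nonneg hp _
  have hbH : prob p (connEvent ends a₂ b ∩ Q) ≤ prob p Q := prob_mono hp Set.inter_subset_right
  have hX0 : 0 ≤ prob p ((connEvent ends a₁ o ∪ connEvent ends a₂ o) ∩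
      (connEvent ends a₁ b ∪ connEvent ends a₂ b) ∩ Q) := prob_nonneg hp _
  have hY0 : 0 ≤ prob p ((connEvent ends a₁ o ∪ connEvent ends a₂ o) ∩ Q) := prob_nonneg hp _
  have hb0 : 0 ≤ prob p (connEvent ends a₂ b ∩ Q) := prob_nonneg hp _
  rcases hQ0.lt_or_eq with hpos | hzero
  · -- divide the three-copy inequality by `P(Q) > 0`
    have hmul : prob p Q * (prob p (connEvent ends a₂ b ∩ Q) *
        prob p ((connEvent ends a₁ o ∪ connEvent ends a₂ o) ∩ Q)) ≤
        prob p Q * (prob p Q * prob p ((connEvent ends a₁ o ∪ connEvent ends a₂ o) ∩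
          (connEvent ends a₁ b ∪ connEvent ends a₂ b) ∩ Q)) := by nlinarith [hsum]
    exact le_of_mul_le_mul_left hmul hpos
  · -- `P(Q) = 0`: both sides vanish
    have hb : prob p (connEvent ends a₂ b ∩ Q) = 0 := le_antisymm (hzero ▸ hbH) hb0
    rw [hb, ← hzero]
    simp
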